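import Literature.NumberTheory.EllipticCurves.PeriodIndexLocalTriviality
import Literature.NumberTheory.EllipticCurves.PeriodIndexProofs
import HarnessLib

/-!
# Clark–Sharif Theorem 2 from the corestricted Kummer classes (assembly of §§3.3–3.6)

`Proofs`-style file (theorems only; no definitions, no named facts) under the provefact seat on
`Literature.NumberTheory.EllipticCurves.ClarkSharif2010_thm2` (Clark–Sharif 2010, Theorem 2).
It assembles the formalized parts of the printed proof —

* the standard trick and the prime-power reduction with the period step
  (`ClarkSharif2010_thm2_of_primePow_torsion_index`, `PeriodIndexProofs`, §3 and §3.6 ¶1);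
* the classes `η = cores_{K_P/K} Φ(a, b) ∈ H¹(K, E)` of §3.3/§3.5 in the subgroup model
  (`coresH1`, `PeriodIndexCorestriction`; `kummerPhi`, `PeriodIndexKummerPhi`), their
  `P`-torsion and their local triviality at the places where `a, b` are local `P`-th powers
  (`PeriodIndexLocalTriviality`, §3.6 last paragraph with §3.2/(SC3'))

— into the reduction `ClarkSharif2010_thm2_of_kummerClasses` of Theorem 2 to exactly the two
inputs of the printed proof that are not yet formalized:

1. `hIP` — `I ∣ P²` for classes of `H¹(K, E)` (Clark–Sharif §1.3 (1), [WCII]; Lang–Tate,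
   Lichtenbaum), the input of the period step;
2. `h` — for every elliptic curve `E/K`, prime power `P` and finite sets of places `S`, `T`:
   a level field `k` (§3.3, `K_P = K(E[P*])`; cf. `exists_levelField` of `PeriodIndexLevelField`)
   with a "basis" `ρ : (ℤ/P)² → E[P]`, and sequences `a_i, b_i ∈ kˣ` (§3.4 Lemma 14:
   `(a_i, b_i) = (π_i, π_i')` or `(π_i, 1)`) such that `a_i, b_i` are `P`-th powers in every
   completion of `k` above `S ∪ T` ((SC1'), (SC3') with the places of `S` put into the modulus)
   and the differences `η_i - η_j`, `i ≠ j`, of the classes `η_i = cores Φ(a_i, b_i)` have index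
   `P²` (§3.4 (SC2'), (SC4'), (SC5'), §3.5 Lemmas 18–19, §3.6: O'Neil's obstruction map,
   Lichtenbaum–Tate duality, Hilbert symbols, the Hasse principle for `Br`).

Given these, Theorem 2 follows formally: `ξ_i = η_i - η_0` has `ξ_0 = 0`, is `P`-torsion
(`nsmul_map_coresH1_kummerPhi_eq_zero`), locally trivial at `S ∪ T`
(`map_coresH1_kummerPhi_mem_localRestrictionKer_of_exists_pow_eq`), and
`ξ_i - ξ_j = η_i - η_j`.

## References

* P. L. Clark, S. Sharif, *Period, index and potential Ш*, Algebra & Number Theory 4 (2010)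
  151–174, §§3.3–3.6; arXiv:0811.3019 read. [ClarkSharif2010]
-/

noncomputable section

open scoped Classical NumberField

universe u

namespace Literature.NumberTheory.EllipticCurves

open GaloisRepresentations Field NumberField IsDedekindDomain

/-- `E[P]` is killed by `P` (as a discrete `𝔤_K`-module). This is Mathlib's
`AddSubgroup.torsionBy.nsmul`; the name is kept for the use below. [folklore] -/
theorem nsmul_geomTorsion_eq_zero {K : Type u} [Field K] (W : WeierstrassCurve K) (P : ℕ)
    (m : ↥(WeierstrassCurve.geomTorsion W (P : ℤ))) : P • m = 0 :=
  AddSubgroup.torsionBy.nsmul m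

/-- The inclusion `E[P] ↪ E(K̄)` is `𝔤_K`-equivariant. [folklore] -/
theorem geomTorsion_subtype_smul {K : Type u} [Field K] (W : WeierstrassCurve K) (P : ℤ)
    (g : absoluteGaloisGroup K) (m : ↥(WeierstrassCurve.geomTorsion W P)) :
    (WeierstrassCurve.geomTorsion W P).subtype (g • m) =
      g • (WeierstrassCurve.geomTorsion W P).subtype m :=
  rfl

/-- **Clark–Sharif 2010, Theorem 2, from the corestricted Kummer classes.**  Theorem 2
(`ClarkSharif2010_thm2`) follows from

* `hIP`: `I(η) ∣ P(η)²` for every class `η ∈ H¹(K, E)` of an elliptic curve over a number field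
  (Clark–Sharif §1.3 (1), citing [WCII]); and
* `h`: for every elliptic curve `W/K`, prime power `P`, and finite sets `S`, `T` of finite and
  infinite places of `K`, the existence of: an intermediate field `K ⊆ k ⊆ K̄` with
  `𝔤_k = fixingGal k` open, normal, of finite index, acting trivially on `E[P]`, and containing a
  primitive `P`-th root of unity `ζ` (§3.3: `k = K_P`); an additive `ρ : (ℤ/P)² → E[P]` (a basis
  of `E[P]`); and sequences `a, b : ℕ → kˣ` (§3.4, Lemma 14) such that (i) for every `v ∈ S`,
  resp. `w ∈ T`, and every `g ∈ 𝔤_K`, `ι(g aᵢ)` and `ι(g bᵢ)` are `P`-th powers in the composite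
  field `K_v(ι(g k)) ⊆ K̄_v` (resp. `K_w(ι(g k))`), `ι = closureEmb` the chosen embedding — i.e.
  `aᵢ, bᵢ` are `P`-th powers in all completions of `k` above `S ∪ T` ((SC1'), (SC3')); and
  (ii) for `i ≠ j` the class `ηᵢ - ηⱼ`, `ηᵢ = cores_{k/K} Φ(aᵢ, bᵢ) ∈ H¹(K, E)`, has index `P²`
  (§§3.4–3.6).

Then `ξᵢ = ηᵢ - η₀` is the sequence of Theorem 2 for the prime power `P`
(`ClarkSharif2010_thm2_of_primePow_torsion_index`). [cite: ClarkSharif2010, Theorem 2, §§3.3–3.6] -/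
theorem ClarkSharif2010_thm2_of_kummerClasses
    (hIP : ∀ {K : Type u} [Field K] [NumberField K] (W : WeierstrassCurve K) [W.IsElliptic]
      (η : W.galH1), index W η ∣ addOrderOf η ^ 2)
    (h : ∀ {K : Type u} [Field K] [NumberField K] (W : WeierstrassCurve K) [W.IsElliptic]
      (P : ℕ) [NeZero P], (∃ p n : ℕ, p.Prime ∧ 0 < n ∧ P = p ^ n) →
        ∀ (S : Finset (HeightOneSpectrum (𝓞 K))) (T : Finset (InfinitePlace K)),
        ∃ (k : IntermediateField K (AlgebraicClosure K))
          (hN : IsOpen (fixingGal k : Set (absoluteGaloisGroup K)))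
          (_ : (fixingGal k).Normal) (_ : Fintype (absoluteGaloisGroup K ⧸ fixingGal k))
          (ζ : AlgebraicClosure K) (hζ : IsPrimitiveRoot ζ P) (hζk : ζ ∈ k)
          (htriv : ∀ (g : fixingGal k) (m : ↥(WeierstrassCurve.geomTorsion W (P : ℤ))),
            g • m = m)
          (ρ : ZMod P × ZMod P →+ ↥(WeierstrassCurve.geomTorsion W (P : ℤ)))
          (a b : ℕ → (↥k)ˣ),
          (∀ i, ∀ v ∈ S, ∀ g : absoluteGaloisGroup K,
            (∃ r ∈ IntermediateField.adjoin (v.adicCompletion K)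
                ((fun y : AlgebraicClosure K ↦ closureEmb (K := K) (v.adicCompletion K) (g • y)) ''
                  (k : Set (AlgebraicClosure K))),
              r ^ P = closureEmb (K := K) (v.adicCompletion K)
                (g • ((a i : k) : AlgebraicClosure K))) ∧
            (∃ r ∈ IntermediateField.adjoin (v.adicCompletion K)
                ((fun y : AlgebraicClosure K ↦ closureEmb (K := K) (v.adicCompletion K) (g • y)) ''
                  (k : Set (AlgebraicClosure K))),
              r ^ P = closureEmb (K := K) (v.adicCompletion K)
                (g • ((b i : k) : AlgebraicClosure K)))) ∧
          (∀ i, ∀ w ∈ T, ∀ g : absoluteGaloisGroup K,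
            (∃ r ∈ IntermediateField.adjoin w.Completion
                ((fun y : AlgebraicClosure K ↦ closureEmb (K := K) w.Completion (g • y)) ''
                  (k : Set (AlgebraicClosure K))),
              r ^ P = closureEmb (K := K) w.Completion (g • ((a i : k) : AlgebraicClosure K))) ∧
            (∃ r ∈ IntermediateField.adjoin w.Completion
                ((fun y : AlgebraicClosure K ↦ closureEmb (K := K) w.Completion (g • y)) ''
                  (k : Set (AlgebraicClosure K))),
              r ^ P = closureEmb (K := K) w.Completion (g • ((b i : k) : AlgebraicClosure K)))) ∧
          ∀ i j, i ≠ j →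
            index W
              (resH1Hom (ContinuousMonoidHom.id (absoluteGaloisGroup K))
                  (WeierstrassCurve.geomTorsion W (P : ℤ)).subtype (geomTorsion_subtype_smul W P)
                  (coresH1 (fixingGal k) hN (kummerPhi hζ hζk htriv ρ (a i) (b i))) -
                resH1Hom (ContinuousMonoidHom.id (absoluteGaloisGroup K))
                  (WeierstrassCurve.geomTorsion W (P : ℤ)).subtype (geomTorsion_subtype_smul W P)
                  (coresH1 (fixingGal k) hN (kummerPhi hζ hζk htriv ρ (a j) (b j)))) =
              P ^ 2) :
    ClarkSharif2010_thm2.{u} := by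
  refine ClarkSharif2010_thm2_of_primePow_torsion_index hIP @fun K _ _ W _ p n hp hn S T ↦ ?_
  haveI : NeZero (p ^ n) := ⟨pow_ne_zero n hp.ne_zero⟩
  obtain ⟨k, hN, _hNn, _hFin, ζ, hζ, hζk, htriv, ρ, a, b, hS, hT, hI⟩ :=
    h W (p ^ n) ⟨p, n, hp, hn, rfl⟩ S T
  -- the classes `η_i = cores Φ(a_i, b_i)` pushed into `H¹(K, E)`
  obtain ⟨η, hη⟩ : ∃ η : ℕ → W.galH1, ∀ i, η i =
      resH1Hom (ContinuousMonoidHom.id (absoluteGaloisGroup K))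
        (WeierstrassCurve.geomTorsion W ((p ^ n : ℕ) : ℤ)).subtype
        (geomTorsion_subtype_smul W ((p ^ n : ℕ) : ℤ))
        (coresH1 (fixingGal k) hN (kummerPhi hζ hζk htriv ρ (a i) (b i))) :=
    ⟨_, fun i ↦ rfl⟩
  have htor : ∀ i, (p ^ n) • η i = 0 := fun i ↦ by
    rw [hη]
    exact nsmul_map_coresH1_kummerPhi_eq_zero hζ hζk htriv ρ (a i) (b i) hN _ _
      (nsmul_geomTorsion_eq_zero W (p ^ n))
  have hlocS : ∀ i, ∀ v ∈ S, η i ∈ W.localRestrictionKer (v.adicCompletion K) := by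
    intro i v hv
    rw [hη]
    exact map_coresH1_kummerPhi_mem_localRestrictionKer_of_exists_pow_eq W _ hζ hζk htriv ρ
      (a i) (b i) hN _ _ (hS i v hv)
  have hlocT : ∀ i, ∀ w ∈ T, η i ∈ W.localRestrictionKer w.Completion := by
    intro i w hw
    rw [hη]
    exact map_coresH1_kummerPhi_mem_localRestrictionKer_of_exists_pow_eq W _ hζ hζk htriv ρ
      (a i) (b i) hN _ _ (hT i w hw)
  refine ⟨fun i ↦ η i - η 0, sub_self _, fun i ↦ ?_, fun i v hv ↦ sub_mem (hlocS i v hv)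
    (hlocS 0 v hv), fun i w hw ↦ sub_mem (hlocT i w hw) (hlocT 0 w hw), fun i j hij ↦ ?_⟩
  · rw [smul_sub, htor, htor, sub_zero]
  · rw [sub_sub_sub_cancel_right, hη, hη]
    exact hI i j hij

end Literature.NumberTheory.EllipticCurves
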